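import Literature.AlgebraicGeometry.Motives.AbelianVarietyAmpleProofs
import Literature.AlgebraicGeometry.Motives.AbelianVarietyTranslationProofs
import Literature.AlgebraicGeometry.Motives.ProjectiveSpaceFunctionField
import HarnessLib

/-!
# The sections `s_y` of `𝒪_A(2D)` cover `A`: the morphism `φ : A → ℙᴺ` of finitely many of them, its fibres lie in translates
# of `A ∖ Supp D`, and `D` is ample as soon as `φ` is finite (Mumford §6 Application 1, linear-system half)

Mumford, *Abelian Varieties*, §6 Application 1 (pp. 60–61), (ii) ⇒ (iii) ⇒ (iv): for an effective divisor `D` on an abelian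
variety `A` over `k = k̄` with `U := A ∖ Supp D`, the theorem of the square gives for every `y ∈ A(k)` a section `s_y` of
`𝒪_A(2D)` with `A_{s_y} = t_y⁻¹U ∩ t_{y⁻¹}⁻¹U` (Görtz–Wedhorn II, Lemma 27.175: `E_y = t_y^*D + t_{y⁻¹}^*D ∼ 2D`); these loci COVER
`A` («the linear system `|2D|` has no base points»); finitely many `y₀, …, y_N` suffice (`A` quasi-compact), so the `s_{yᵢ}`
generate `𝒪_A(2D)` and define `φ : A → ℙᴺ_k` with `φ⁻¹D₊(xᵢ) = A_{s_{yᵢ}}` (Hartshorne II Thm. 7.1); every fibre of `φ` lies in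
ONE `A_{s_{yᵢ}} ⊆ t_{yᵢ}⁻¹U`; and IF `φ` is finite then the `A_{s_{yᵢ}} = φ⁻¹D₊(xᵢ)` are affine and `D` is ample
(Görtz–Wedhorn I, Prop. 13.47 (iv) with `d = 2`).  The finiteness of `φ` (from the finiteness of `{x : t_x(Supp D) = Supp D}`,
Mumford p. 61) is the other half of Application 1 (`Motives/AbelianVarietyFiniteOfFibreTranslate`, cell `hodgecm-mathlib`
(V7-c-ii)); this file is the LINEAR-SYSTEM HALF (V7-c-i).

THEOREMS ONLY (no definition, no named fact, no `sorry`; the generating-sections datum `G` and `φ := G.toProj A.X.hom` are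
existential witnesses ∕ binders):

* `AbelianVariety.exists_isSection_two_smul_mem_nonvanishing` — base-point freeness of `|2D|` by the sections `s_y` (the pointwise
  half of ★ `isAmple_of_isEffective_of_avoids_iff`, Görtz–Wedhorn II 27.174/27.175, WITHOUT the affineness of `U`);
* `AbelianVariety.exists_generatingSections_two_smul` — finitely many `s_{yᵢ}` whose loci cover: generating sections
  `G : GeneratingSections (Fin (N+1)) A` with `G.U i = A_{s_{yᵢ}} = t_{yᵢ}⁻¹U ⊓ t_{yᵢ⁻¹}⁻¹U`;
* `AbelianVariety.isProper_toProj`, `AbelianVariety.jacobsonSpace_proj` — `φ := G.toProj A.X.hom : A → ℙᴺ_k` is proper, `ℙᴺ_k` is Jacobson;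
* `AbelianVariety.exists_preimage_toProj_singleton_subset` — **the (c-i → c-ii) socket `hcov`**: every fibre `φ⁻¹(p)` lies in
  `t_y⁻¹(A ∖ Supp D)` for some `y ∈ A(k)`;
* `AbelianVariety.isAmple_of_isFinite_toProj` — **the exit**: `φ` finite ⇒ `D` ample (`d = 2`).

COUNT-NEUTRAL capital on the road G5 to row VI-7 (F-R) (D-0151; crux HLiu418 = stmt-HodgeConjecture-24832).  HC_CM is proved only
modulo the 7 printed citations until rung 0 closes.

## References
* [MumfordAV1970] D. Mumford, *Abelian Varieties* (1970), §6 Application 1 (pp. 60–61) and Cor. 4 (p. 59).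
* [GortzWedhorn2023] U. Görtz, T. Wedhorn, *Algebraic Geometry II* (2023), Prop. 27.174 and Lemma 27.175 (pp. 669–670).
* [GortzWedhorn2020] U. Görtz, T. Wedhorn, *Algebraic Geometry I*, 2nd ed. (2020), Prop. 13.47 (iv) (pp. 392–394); Thm. 13.84 / Cor. 12.89.
* [Hartshorne1977] R. Hartshorne, *Algebraic Geometry* (1977), II Thm. 7.1.
-/

noncomputable section

open CategoryTheory AlgebraicGeometry TopologicalSpace
open Literature.AlgebraicGeometry.Motives.Segre (grading X_mem irrelevant_le_span_X toSpec)


universe u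


namespace Literature.AlgebraicGeometry.Motives

namespace AbelianVariety

open RatFn CartierDivisor

variable {k : Type u} [Field k] (A : AbelianVariety k)

/-! ## §1 Base-point freeness of `|2D|` by the sections `s_y` -/

/-- **`|2D|` is base-point free, pointwise by the `s_y`** (Mumford §6 Appl. 1 (ii)⇒(iii); Görtz–Wedhorn II, proof of Lemma 27.175):
for an effective `D` with `U = A ∖ Supp D` and ANY point `x ∈ A` there are `y ∈ A(k)` and a section `s` of `𝒪_A(2D)` with
`A_s = t_y⁻¹U ∩ t_{y⁻¹}⁻¹U ∋ x` (for the closed point `x₀ ⤳`-below `x`, any closed `y` in the non-empty open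
`t_{x₀}⁻¹U ∩ ([−1] ≫ t_{x₀})⁻¹U`; ★ `exists_isSection_two_smul_of_theoremOfTheSquare`, ★ `theoremOfTheSquare_holds`).
[cite: MumfordAV1970, §6 Application 1 (pp. 60–61)] [cite: GortzWedhorn2023, Prop. 27.174 and Lemma 27.175 (pp. 669–670)] -/
theorem exists_isSection_two_smul_mem_nonvanishing [IsAlgClosed k] {D : CartierDivisor A.X.left} (hD : D.IsEffective)
    (x : A.X.left) :
    ∃ (y : A.Points k) (s : A.X.left.functionField), ((2 : ℕ) • D).IsSection s ∧
      ((2 : ℕ) • D).nonvanishingOpens s =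
        (A.translation y).left ⁻¹ᵁ D.nonvanishingOpens 1 ⊓ (A.translation y⁻¹).left ⁻¹ᵁ D.nonvanishingOpens 1 ∧
      x ∈ ((2 : ℕ) • D).nonvanishing s := by
  haveI := A.irreducibleSpace_left
  have hDU : ∀ z, D.Avoids z ↔ z ∈ D.nonvanishingOpens (1 : A.X.left.functionField) := fun z =>
    avoids_iff_mem_nonvanishing_one
  -- `U` contains the generic point
  have hξU : genericPoint A.X.left ∈ D.nonvanishingOpens (1 : A.X.left.functionField) :=
    (hDU _).1 fun i _ => isUnitAt_genericPoint (D.f_ne_zero i)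
  -- `x` specialises to a closed point `x₀`
  obtain ⟨x₀, hx₀c, hx₀⟩ := A.exists_isClosed_specializes x
  have h₁ : ((A.translation (A.pointOfClosed x₀ hx₀c)).left ⁻¹ᵁ D.nonvanishingOpens (1 : A.X.left.functionField) :
      Set A.X.left).Nonempty := by
    obtain ⟨z, hz⟩ := (A.translation (A.pointOfClosed x₀ hx₀c)).left.surjective (genericPoint A.X.left)
    exact ⟨z, show (A.translation (A.pointOfClosed x₀ hx₀c)).left z ∈ D.nonvanishingOpens (1 : A.X.left.functionField) by
      rw [hz]; exact hξU⟩
  have h₂ : (((A.zsmulPt (-1)).left ≫ (A.translation (A.pointOfClosed x₀ hx₀c)).left) ⁻¹ᵁ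
      D.nonvanishingOpens (1 : A.X.left.functionField) : Set A.X.left).Nonempty := by
    obtain ⟨z, hz⟩ :=
      ((A.zsmulPt (-1)).left ≫ (A.translation (A.pointOfClosed x₀ hx₀c)).left).surjective (genericPoint A.X.left)
    exact ⟨z, show ((A.zsmulPt (-1)).left ≫ (A.translation (A.pointOfClosed x₀ hx₀c)).left) z ∈
      D.nonvanishingOpens (1 : A.X.left.functionField) by rw [hz]; exact hξU⟩
  obtain ⟨y₀, hy₀c, hy₀V⟩ := A.exists_isClosed_mem_of_isOpen
    (((A.translation (A.pointOfClosed x₀ hx₀c)).left ⁻¹ᵁ D.nonvanishingOpens (1 : A.X.left.functionField)).2.inter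
      (((A.zsmulPt (-1)).left ≫ (A.translation (A.pointOfClosed x₀ hx₀c)).left) ⁻¹ᵁ
        D.nonvanishingOpens (1 : A.X.left.functionField)).2)
    (nonempty_preirreducible_inter
      ((A.translation (A.pointOfClosed x₀ hx₀c)).left ⁻¹ᵁ D.nonvanishingOpens (1 : A.X.left.functionField)).2
      (((A.zsmulPt (-1)).left ≫ (A.translation (A.pointOfClosed x₀ hx₀c)).left) ⁻¹ᵁ
        D.nonvanishingOpens (1 : A.X.left.functionField)).2 h₁ h₂)
  have hy₁ : (A.translation (A.pointOfClosed x₀ hx₀c)).left y₀ ∈ D.nonvanishingOpens (1 : A.X.left.functionField) := hy₀V.1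
  have hy₂ : (A.translation (A.pointOfClosed x₀ hx₀c)).left ((A.zsmulPt (-1)).left y₀) ∈
      D.nonvanishingOpens (1 : A.X.left.functionField) := by
    have h2 : y₀ ∈ ((A.zsmulPt (-1)).left ≫ (A.translation (A.pointOfClosed x₀ hx₀c)).left) ⁻¹ᵁ
        D.nonvanishingOpens (1 : A.X.left.functionField) := hy₀V.2
    rwa [Scheme.Hom.mem_preimage, Scheme.Hom.comp_apply] at h2
  -- the section `s_y` of `𝒪(2D)` for `y = y₀`
  obtain ⟨s, hs, hns⟩ :=
    exists_isSection_two_smul_of_theoremOfTheSquare A.theoremOfTheSquare_holds hD hDU (A.pointOfClosed y₀ hy₀c)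
  refine ⟨A.pointOfClosed y₀ hy₀c, s, hs, hns, ?_⟩
  refine hx₀.mem_open (isOpen_nonvanishing _ _) ?_
  rw [← mem_nonvanishingOpens, hns, Opens.mem_inf, Scheme.Hom.mem_preimage, Scheme.Hom.mem_preimage,
    ← A.pt_pointOfClosed x₀ hx₀c, translation_apply_pt_comm,
    translation_apply_pt_comm (A.pointOfClosed x₀ hx₀c) (A.pointOfClosed y₀ hy₀c)⁻¹, ← zsmulPt_neg_one_apply_pt,
    pt_pointOfClosed]
  exact ⟨hy₁, hy₂⟩

/-! ## §2 Finitely many `s_{yᵢ}` cover: the generating sections of `𝒪_A(2D)` -/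

/-- **Finitely many of the `s_y` generate `𝒪_A(2D)`** (Mumford §6 Appl. 1 (iii): the complete linear system `|2D|` is base-point
free; here by quasi-compactness of `A` and §1): sections `s₀, …, s_N` of `𝒪_A(2D)` with `A_{sᵢ} = t_{yᵢ}⁻¹U ∩ t_{yᵢ⁻¹}⁻¹U`
covering `A`, packaged as generating-sections data (★ `CartierDivisor.toGeneratingSections`, Hartshorne II Thm. 7.1).
[cite: MumfordAV1970, §6 Application 1 (pp. 60–61)] [cite: Hartshorne1977, II Thm. 7.1] -/
theorem exists_generatingSections_two_smul [IsAlgClosed k] {D : CartierDivisor A.X.left} (hD : D.IsEffective) :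
    ∃ (N : ℕ) (y : Fin (N + 1) → A.Points k) (s : Fin (N + 1) → A.X.left.functionField)
      (G : GeneratingSections (Fin (N + 1)) A.X.left),
      (∀ i, ((2 : ℕ) • D).IsSection (s i)) ∧ (∀ i, G.U i = ((2 : ℕ) • D).nonvanishingOpens (s i)) ∧
      ∀ i, G.U i = (A.translation (y i)).left ⁻¹ᵁ D.nonvanishingOpens 1 ⊓
        (A.translation (y i)⁻¹).left ⁻¹ᵁ D.nonvanishingOpens 1 := by
  classical
  choose y s hs hns hmem using fun x => A.exists_isSection_two_smul_mem_nonvanishing hD x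
  let V : A.X.left → Set A.X.left := fun x => (((2 : ℕ) • D).nonvanishingOpens (s x) : Set A.X.left)
  have hcover : (Set.univ : Set A.X.left) ⊆ ⋃ x, V x := fun x _ => Set.mem_iUnion.2 ⟨x, hmem x⟩
  obtain ⟨t, ht⟩ := isCompact_univ.elim_finite_subcover V (fun x => (((2 : ℕ) • D).nonvanishingOpens (s x)).isOpen) hcover
  have htne : t.Nonempty := by
    obtain ⟨x⟩ := (inferInstance : Nonempty A.X.left)
    obtain ⟨z, hz, -⟩ := Set.mem_iUnion₂.1 (ht (Set.mem_univ x))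
    exact ⟨z, hz⟩
  obtain ⟨N, hN⟩ : ∃ N, t.card = N + 1 := Nat.exists_eq_succ_of_ne_zero (Finset.card_ne_zero.2 htne)
  let e : Fin (N + 1) ≃ ↥t := (t.equivFin.trans (finCongr hN)).symm
  have hcov : ∀ x : A.X.left, ∃ i : Fin (N + 1), x ∈ ((2 : ℕ) • D).nonvanishing (s (e i)) := fun x => by
    obtain ⟨z, hz, hxz⟩ := Set.mem_iUnion₂.1 (ht (Set.mem_univ x))
    refine ⟨e.symm ⟨z, hz⟩, ?_⟩
    simp only [Equiv.apply_symm_apply]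
    exact hxz
  exact ⟨N, fun i => y (e i), fun i => s (e i),
    ((2 : ℕ) • D).toGeneratingSections (fun i => s (e i)) (fun i => hs _) (fun i => RatFn.genericPoint_mem_of_mem (hmem (e i))) hcov,
    fun i => hs _, fun i => rfl, fun i => hns _⟩

/-! ## §3 The morphism `φ : A → ℙᴺ_k` of generating sections: proper, Jacobson target, fibres in translates of `A ∖ Supp D` -/

/-- `ℙᴺ_k = Proj k[x₀, …, x_N]` is a Jacobson space: it is locally of finite type over the field `k`, so its closed points are very
dense (Görtz–Wedhorn I, Prop. 3.35; Mathlib `LocallyOfFiniteType.jacobsonSpace`). [cite: GortzWedhorn2020, Prop. 3.35] -/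
theorem jacobsonSpace_proj (N : ℕ) : JacobsonSpace ↥(ProjSpace.P N k) :=
  LocallyOfFiniteType.jacobsonSpace (ProjSpace.P N k ↘ Spec (.of k))

/-- **`φ := G.toProj : A → ℙᴺ_k` is proper** for any generating-sections datum on the abelian variety `A` (`A` is proper over `k`,
`ℙᴺ_k → Spec k` is separated, `φ` is a `k`-morphism ★ `toProj_toSpec`; Görtz–Wedhorn I, Prop. 12.58∕Cor. 13.72 pattern).
[cite: GortzWedhorn2020, Summary 13.71 and Cor. 13.72 (pp. 404–405)] -/
theorem isProper_toProj {N : ℕ} (G : GeneratingSections (Fin (N + 1)) A.X.left) : IsProper (G.toProj A.X.hom) := by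
  have h1 : IsProper (G.toProj A.X.hom ≫ toSpec (Fin (N + 1)) k) := by
    rw [G.toProj_toSpec]
    infer_instance
  haveI : IsSeparated (toSpec (Fin (N + 1)) k) := inferInstanceAs (IsSeparated (ProjSpace.P N k ↘ Spec (.of k)))
  exact IsProper.of_comp (G.toProj A.X.hom) (toSpec (Fin (N + 1)) k)

/-- **The socket `hcov` (every fibre of `φ` misses a translate of `Supp D`)**: for the generating sections of §2 and ANY point `p` of
`ℙᴺ`, the fibre `φ⁻¹(p)` lies in `t_y⁻¹(A ∖ Supp D)` for some `y ∈ A(k)` — `p ∈ D₊(xᵢ)` for some `i` (the `D₊(xᵢ)` cover), and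
`φ⁻¹D₊(xᵢ) = A_{sᵢ} = t_{yᵢ}⁻¹U ∩ t_{yᵢ⁻¹}⁻¹U` (★ `toProj_preimage_basicOpen`).  Mumford p. 61: «`B̃ ⊂ σ⁻¹(U_i)`».
[cite: MumfordAV1970, §6 Application 1 (pp. 60–61)] [cite: Hartshorne1977, II Thm. 7.1] -/
theorem preimage_toProj_singleton_subset {D : CartierDivisor A.X.left} {N : ℕ} (y : Fin (N + 1) → A.Points k)
    (G : GeneratingSections (Fin (N + 1)) A.X.left)
    (hG : ∀ i, G.U i = (A.translation (y i)).left ⁻¹ᵁ D.nonvanishingOpens 1 ⊓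
      (A.translation (y i)⁻¹).left ⁻¹ᵁ D.nonvanishingOpens 1)
    (p : ↥(ProjSpace.P N k)) :
    ∃ y₀ : A.Points k, (G.toProj A.X.hom).base ⁻¹' {p} ⊆ (A.translation y₀).left.base ⁻¹' (D.nonvanishing 1) := by
  letI := MvPolynomial.gradedAlgebra (σ := Fin (N + 1)) (R := k)
  -- `p` lies in some standard chart `D₊(x_i)`
  have hp : p ∈ (⨆ i : Fin (N + 1), Proj.basicOpen (grading (Fin (N + 1)) k) (MvPolynomial.X i)) := by
    rw [Proj.iSup_basicOpen_eq_top (grading (Fin (N + 1)) k) (fun i => (MvPolynomial.X i : MvPolynomial (Fin (N + 1)) k))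
      (irrelevant_le_span_X (Fin (N + 1)) k)]
    trivial
  obtain ⟨i, hi⟩ := Opens.mem_iSup.mp hp
  refine ⟨y i, fun z hz => ?_⟩
  have hz' : z ∈ G.toProj A.X.hom ⁻¹ᵁ Proj.basicOpen (grading (Fin (N + 1)) k) (MvPolynomial.X i) := by
    show (G.toProj A.X.hom).base z ∈ Proj.basicOpen (grading (Fin (N + 1)) k) (MvPolynomial.X i)
    rw [show (G.toProj A.X.hom).base z = p from hz]
    exact hi
  rw [G.toProj_preimage_basicOpen, hG i] at hz'
  exact hz'.1

/-- The same socket in the shape quantified over closed points only (the form (V7-c-ii) consumes).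
[cite: MumfordAV1970, §6 Application 1 (pp. 60–61)] -/
theorem preimage_toProj_singleton_subset_of_isClosed {D : CartierDivisor A.X.left} {N : ℕ} (y : Fin (N + 1) → A.Points k)
    (G : GeneratingSections (Fin (N + 1)) A.X.left)
    (hG : ∀ i, G.U i = (A.translation (y i)).left ⁻¹ᵁ D.nonvanishingOpens 1 ⊓
      (A.translation (y i)⁻¹).left ⁻¹ᵁ D.nonvanishingOpens 1) :
    ∀ p : ↥(ProjSpace.P N k), IsClosed ({p} : Set ↥(ProjSpace.P N k)) →
      ∃ y₀ : A.Points k, (G.toProj A.X.hom).base ⁻¹' {p} ⊆ (A.translation y₀).left.base ⁻¹' (D.nonvanishing 1) :=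
  fun p _ => A.preimage_toProj_singleton_subset y G hG p

/-! ## §4 The exit: `φ` finite ⇒ `D` ample -/

/-- **If the morphism `φ : A → ℙᴺ_k` of finitely many sections `sᵢ` of `𝒪_A(2D)` covering `A` is FINITE, then `D` is ample**
(Mumford §6 Appl. 1 (iii)⇒(iv); Görtz–Wedhorn I Prop. 13.47 (iv) with `d = 2`): `φ` is affine, so `A_{sᵢ} = φ⁻¹D₊(xᵢ)` is affine
(★ `toProj_preimage_basicOpen`, Mathlib `Proj.isAffineOpen_basicOpen`), and every point lies in some `A_{sᵢ}`.
[cite: MumfordAV1970, §6 Application 1 (pp. 60–61)] [cite: GortzWedhorn2020, Prop. 13.47 (iv) (pp. 392–394)] -/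
theorem isAmple_of_isFinite_toProj {D : CartierDivisor A.X.left} {N : ℕ} (s : Fin (N + 1) → A.X.left.functionField)
    (hs : ∀ i, ((2 : ℕ) • D).IsSection (s i)) (G : GeneratingSections (Fin (N + 1)) A.X.left)
    (hU : ∀ i, G.U i = ((2 : ℕ) • D).nonvanishingOpens (s i)) [IsFinite (G.toProj A.X.hom)] : D.IsAmple := by
  letI := MvPolynomial.gradedAlgebra (σ := Fin (N + 1)) (R := k)
  refine ⟨inferInstance, inferInstance, 2, two_pos, fun x => ?_⟩
  -- `x` lies in some `A_{s_i} = G.U i`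
  have hx : x ∈ (⨆ i, G.U i) := by rw [G.iSup_U]; trivial
  obtain ⟨i, hi⟩ := Opens.mem_iSup.mp hx
  refine ⟨s i, hs i, ?_, ?_⟩
  · rw [← mem_nonvanishingOpens, ← hU i]
    exact hi
  · rw [← hU i, ← G.toProj_preimage_basicOpen A.X.hom i]
    exact (Proj.isAffineOpen_basicOpen (grading (Fin (N + 1)) k) (MvPolynomial.X i) (X_mem k i) zero_lt_one).preimage (G.toProj A.X.hom)

/-- **Linear-system half of Mumford §6 Application 1, assembled**: for an effective `D` on the abelian variety `A` over `k = k̄`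
there are `N`, rational points `y₀, …, y_N` and generating sections `G` of `𝒪_A(2D)` with `G.U i = t_{yᵢ}⁻¹U ∩ t_{yᵢ⁻¹}⁻¹U`
(`U = A ∖ Supp D`), whose morphism `φ = G.toProj : A → ℙᴺ_k` is proper with every fibre inside some `t_y⁻¹U`, and such that
`D` is ample as soon as `φ` is finite. [cite: MumfordAV1970, §6 Application 1 (pp. 60–61)] [cite: GortzWedhorn2023, Prop. 27.174 and Lemma 27.175 (pp. 669–670)] -/
theorem exists_toProj_two_smul [IsAlgClosed k] {D : CartierDivisor A.X.left} (hD : D.IsEffective) :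
    ∃ (N : ℕ) (y : Fin (N + 1) → A.Points k) (G : GeneratingSections (Fin (N + 1)) A.X.left),
      (∀ i, G.U i = (A.translation (y i)).left ⁻¹ᵁ D.nonvanishingOpens 1 ⊓
        (A.translation (y i)⁻¹).left ⁻¹ᵁ D.nonvanishingOpens 1) ∧
      IsProper (G.toProj A.X.hom) ∧
      (∀ p : ↥(ProjSpace.P N k),
        ∃ y₀ : A.Points k, (G.toProj A.X.hom).base ⁻¹' {p} ⊆ (A.translation y₀).left.base ⁻¹' (D.nonvanishing 1)) ∧
      (IsFinite (G.toProj A.X.hom) → D.IsAmple) := by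
  obtain ⟨N, y, s, G, hs, hU, hG⟩ := A.exists_generatingSections_two_smul hD
  exact ⟨N, y, G, hG, A.isProper_toProj G, A.preimage_toProj_singleton_subset y G hG,
    fun _ => A.isAmple_of_isFinite_toProj s hs G hU⟩

/-! ## §5 The conditional head: `D` is ample once every such `φ` is finite -/

/-- **Mumford §6 Application 1, (ii) ⇒ (iv), modulo the finiteness half**: if every proper `φ : A → P` to a Jacobson scheme whose
closed fibres each lie in a translate of `A ∖ Supp D` is FINITE (the conclusion of the finiteness half (V7-c-ii),
`Motives/AbelianVarietyFiniteOfFibreTranslate`, from the finiteness of the stabiliser `{x : t_x(Supp D) = Supp D}`), then the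
effective divisor `D` is ample — apply it to the morphism `φ = G.toProj` of §§2–4. [cite: MumfordAV1970, §6 Application 1 (pp. 60–61)] -/
theorem isAmple_of_isEffective_of_forall_isFinite [IsAlgClosed k] {D : CartierDivisor A.X.left} (hD : D.IsEffective)
    (hfin : ∀ (P : Scheme.{u}) (φ : A.X.left ⟶ P) [IsProper φ] [JacobsonSpace ↥P],
      (∀ p : ↥P, IsClosed ({p} : Set ↥P) →
        ∃ y : A.Points k, φ.base ⁻¹' {p} ⊆ (A.translation y).left.base ⁻¹' (D.nonvanishing 1)) → IsFinite φ) :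
    D.IsAmple := by
  obtain ⟨N, y, s, G, hs, hU, hG⟩ := A.exists_generatingSections_two_smul hD
  haveI := A.isProper_toProj G
  haveI := jacobsonSpace_proj (k := k) N
  haveI : IsFinite (G.toProj A.X.hom) :=
    hfin (ProjSpace.P N k) (G.toProj A.X.hom) (A.preimage_toProj_singleton_subset_of_isClosed y G hG)
  exact A.isAmple_of_isFinite_toProj s hs G hU

end AbelianVariety

end Literature.AlgebraicGeometry.Motives

end
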